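import Mathlib.Analysis.SpecialFunctions.Pow.Deriv
import Mathlib.Analysis.SpecialFunctions.Pow.Continuity
import Literature.NumberTheory.Transcendental.KZCalculusProofs

/-!
# The `u`-potential of the Elliott cusp-transport certificate (engine client E-L2b)

Line cusp-transport-to-the-beta-world of the crux `CompleteModGammaSector`
(stmt-KontsevichZagierPeriods-14233), second client (ElliottToCusp) of the certificate-transport
engine E2', stub `stub_elliottPotentialU`.

For rational `0 < a < 1`, `1 − a < c` and a modulus `s ∈ (0, 1)` the Elliott family
`F = K · (1 − s t − (1 − s) u)` with
`K = t^{−a} (1 − t)^{c+a−2} (1 − s t)^{−a} · u^{−a} (1 − u)^{c+a−2} (1 − (1 − s) u)^{−a}`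
satisfies the divergence certificate `∂ₛ F = ∂ₜ P + ∂ᵤ Q` with the `u`-potential
`Q = −t^{1−a} (1 − t)^{c+a−2} (1 − s t)^{−a} · u^{1−a} (1 − u)^{c+a−1} (1 − (1 − s) u)^{−a}`.
The engine needs, in the `u`-direction, that `Q` is continuous on the closed fibre `[0, 1]`,
vanishes on both faces, and has the prescribed derivative
`g₂ = −K · t · [(1 − 2u) − a (1 − u) − (c + a − 2) u + a (1 − s) u (1 − u)/(1 − (1 − s) u)]` inside.
`Q = −M · ψ` with the `u`-free constant `M = t^{1−a} (1 − t)^{c+a−2} (1 − s t)^{−a}` and the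
one-variable function `ψ(v) = v^{1−a} (1 − v)^{c+a−1} (1 − (1 − s) v)^{−a}`, whose elementary
calculus on `[0, 1]` is done once (`elliottPsi_continuousOn`, `elliottPsi_hasDerivAt`, after the
template `KZ.hasDerivAt_rpow_mul_one_sub_rpow`): the exponents `1 − a`, `c + a − 1` are positive
and `1 − (1 − s) v ≥ s > 0` on `[0, 1]`.
-/

noncomputable section
set_option linter.dupNamespace false

namespace Summit.KontsevichZagierPeriods.KontsevichZagierPeriods.CompleteModGammaSectorEngine

open MeasureTheory Set
open Literature.NumberTheory.Transcendental
open Literature.NumberTheory.Transcendental.KZ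

/-- For `s ∈ (0, 1)` and `v ∈ [0, 1]` the third base is positive:
`1 − (1 − s) v ≥ 1 − (1 − s) = s > 0`. [folklore] -/
private theorem elliottPsi_base_pos {s v : ℝ} (hs : s ∈ Set.Ioo (0:ℝ) 1)
    (hv : v ∈ Set.Icc (0:ℝ) 1) :
    0 < 1 - (1 - s) * v := by
  have h1 : (1 - s) * v ≤ (1 - s) := mul_le_of_le_one_right (by linarith [hs.2]) hv.2
  linarith [hs.1]

/-- Continuity of `ψ(v) = v^{1−a} (1 − v)^{c+a−1} (1 − (1 − s) v)^{−a}` on `[0, 1]` for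
`a < 1`, `1 − a < c` (nonnegative exponents on the vanishing bases) and `s ∈ (0, 1)`
(positive third base). [folklore] -/
private theorem elliottPsi_continuousOn {a c s : ℝ} (ha1 : a < 1) (hac : 1 - a < c)
    (hs : s ∈ Set.Ioo (0:ℝ) 1) :
    ContinuousOn (fun v : ℝ => v ^ (1 - a) * (1 - v) ^ (c + a - 1) * (1 - (1 - s) * v) ^ (-a))
      (Set.Icc (0:ℝ) 1) := by
  refine ((continuousOn_id.rpow_const fun v _ => Or.inr (by linarith)).mul
    ((continuousOn_const.sub continuousOn_id).rpow_const fun v _ => Or.inr (by linarith))).mul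
    ((continuousOn_const.sub (continuousOn_const.mul continuousOn_id)).rpow_const
      fun v hv => Or.inl (elliottPsi_base_pos hs hv).ne')

/-- Derivative of `ψ(v) = v^{1−a} (1 − v)^{c+a−1} (1 − (1 − s) v)^{−a}` at an interior point
`u ∈ (0, 1)` (`s ∈ (0, 1)`), in factored form:
`ψ'(u) = u^{−a} (1 − u)^{c+a−2} (1 − (1 − s) u)^{−a} ·
  [(1 − 2u) − a (1 − u) − (c + a − 2) u + a (1 − s) u (1 − u)/(1 − (1 − s) u)]`. [folklore] -/
private theorem elliottPsi_hasDerivAt {a c s : ℝ} (hs : s ∈ Set.Ioo (0:ℝ) 1) {u : ℝ}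
    (hu : u ∈ Set.Ioo (0:ℝ) 1) :
    HasDerivAt (fun v : ℝ => v ^ (1 - a) * (1 - v) ^ (c + a - 1) * (1 - (1 - s) * v) ^ (-a))
      (u ^ (-a) * (1 - u) ^ (c + a - 2) * (1 - (1 - s) * u) ^ (-a) *
        ((1 - 2 * u) - a * (1 - u) - (c + a - 2) * u
          + a * (1 - s) * u * (1 - u) / (1 - (1 - s) * u))) u := by
  have hu0 : u ≠ 0 := hu.1.ne'
  have h1u : 1 - u ≠ 0 := (sub_pos.2 hu.2).ne'
  have hw : 1 - (1 - s) * u ≠ 0 := (elliottPsi_base_pos hs (Ioo_subset_Icc_self hu)).ne'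
  have hA : HasDerivAt (fun v : ℝ => v ^ (1 - a)) ((1 - a) * u ^ (-a)) u := by
    have h := Real.hasDerivAt_rpow_const (p := 1 - a) (Or.inl hu0)
    rwa [show (1 - a) - 1 = -a by ring] at h
  have hB : HasDerivAt (fun v : ℝ => (1 - v) ^ (c + a - 1))
      (-(c + a - 1) * (1 - u) ^ (c + a - 2)) u := by
    have h := ((hasDerivAt_id' u).const_sub 1).rpow_const (p := c + a - 1) (Or.inl h1u)
    convert h using 1
    rw [show (c + a - 1) - 1 = c + a - 2 by ring]
    ring
  have hC : HasDerivAt (fun v : ℝ => (1 - (1 - s) * v) ^ (-a))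
      ((1 - s) * a * ((1 - (1 - s) * u) ^ (-a) / (1 - (1 - s) * u))) u := by
    have h := (((hasDerivAt_id' u).const_mul (1 - s)).const_sub 1).rpow_const (p := -a)
      (Or.inl hw)
    convert h using 1
    rw [Real.rpow_sub_one hw]
    ring
  refine ((hA.fun_mul hB).fun_mul hC).congr_deriv ?_
  have e1 : u ^ (1 - a) = u ^ (-a) * u := by rw [← Real.rpow_add_one hu0, neg_add_eq_sub]
  have e2 : (1 - u) ^ (c + a - 1) = (1 - u) ^ (c + a - 2) * (1 - u) := by
    rw [← Real.rpow_add_one h1u]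
    congr 1
    ring
  rw [e1, e2]
  ring

/-- **Potential `Q`** of the Elliott certificate (`u`-direction):
`Q(v) = −t^{1−a} (1 − t)^{c+a−2} (1 − s t)^{−a} · v^{1−a} (1 − v)^{c+a−1} (1 − (1 − s) v)^{−a}`
is continuous in `v` on `[0, 1]`, vanishes at `v = 0` and `v = 1`, and has derivative
`g₂(u) = −(K(t, u, s) · t · [(1 − 2u) − a (1 − u) − (c + a − 2) u + a (1 − s) u (1 − u)/(1 − (1 − s) u)])`,
`K(t, u, s) = t^{−a} (1 − t)^{c+a−2} (1 − s t)^{−a} u^{−a} (1 − u)^{c+a−2} (1 − (1 − s) u)^{−a}`,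
at every `u ∈ (0, 1)` (rational `0 < a < 1`, `1 − a < c`; `t, s ∈ (0, 1)`). [folklore] -/
theorem stub_elliottPotentialU :
    ∀ (a c : ℚ) (t s : ℝ), 0 < a → a < 1 → 1 - a < c → t ∈ Set.Ioo (0:ℝ) 1 → s ∈ Set.Ioo (0:ℝ) 1 → ContinuousOn (fun v : ℝ => (-(t ^ (1 - (a : ℝ)) * (1 - t) ^ ((c : ℝ) + (a : ℝ) - 2) * (1 - s * t) ^ (-(a : ℝ)) * v ^ (1 - (a : ℝ)) * (1 - v) ^ ((c : ℝ) + (a : ℝ) - 1) * (1 - (1 - s) * v) ^ (-(a : ℝ))))) (Set.Icc (0:ℝ) 1) ∧ (-(t ^ (1 - (a : ℝ)) * (1 - t) ^ ((c : ℝ) + (a : ℝ) - 2) * (1 - s * t) ^ (-(a : ℝ)) * (0:ℝ) ^ (1 - (a : ℝ)) * (1 - (0:ℝ)) ^ ((c : ℝ) + (a : ℝ) - 1) * (1 - (1 - s) * (0:ℝ)) ^ (-(a : ℝ)))) = 0 ∧ (-(t ^ (1 - (a : ℝ)) * (1 - t) ^ ((c : ℝ) + (a : ℝ) - 2) * (1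 - s * t) ^ (-(a : ℝ)) * (1:ℝ) ^ (1 - (a : ℝ)) * (1 - (1:ℝ)) ^ ((c : ℝ) + (a : ℝ) - 1) * (1 - (1 - s) * (1:ℝ)) ^ (-(a : ℝ)))) = 0 ∧ ∀ u ∈ Set.Ioo (0:ℝ) 1, HasDerivAt (fun v : ℝ => (-(t ^ (1 - (a : ℝ)) * (1 - t) ^ ((c : ℝ) + (a : ℝ) - 2) * (1 - s * t) ^ (-(a : ℝ)) * v ^ (1 - (a : ℝ)) * (1 - v) ^ ((c : ℝ) + (a : ℝ) - 1) * (1 - (1 - s) * v) ^ (-(a : ℝ))))) (-((t ^ (-(a : ℝ)) * (1 - t) ^ ((c : ℝ) + (a : ℝ) - 2) * (1 - s * t) ^ (-(a : ℝ)) * u ^ (-(a : ℝ)) * (1 - u) ^ ((c : ℝ) + (a : ℝ) - 2) * (1 - (1 - s) * u) ^ (-(a : ℝ))) * t * ((1 - 2 * u) - (a : ℝ) * (1 - u) - ((c : ℝ) + (a : ℝ) - 2) * u + (a : ℝ) * (1 - s) * u * (1 - u) / (1 - (1 - s) * u)))) u := by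
  intro a c t s ha0 ha1 hac ht hs
  have ha1R : (a : ℝ) < 1 := by exact_mod_cast ha1
  have hacR : 1 - (a : ℝ) < c := by exact_mod_cast hac
  have hne1 : (1 : ℝ) - a ≠ 0 := (sub_pos.2 ha1R).ne'
  have hne2 : (c : ℝ) + a - 1 ≠ 0 := by
    have : (0 : ℝ) < c + a - 1 := by linarith
    exact this.ne'
  -- `Q = (−M) · ψ` with the `v`-free constant `M = t^{1−a} (1 − t)^{c+a−2} (1 − s t)^{−a}`
  have hfun : (fun v : ℝ => (-(t ^ (1 - (a : ℝ)) * (1 - t) ^ ((c : ℝ) + (a : ℝ) - 2) *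
      (1 - s * t) ^ (-(a : ℝ)) * v ^ (1 - (a : ℝ)) * (1 - v) ^ ((c : ℝ) + (a : ℝ) - 1) *
      (1 - (1 - s) * v) ^ (-(a : ℝ))))) =
      fun v : ℝ => (-(t ^ (1 - (a : ℝ)) * (1 - t) ^ ((c : ℝ) + (a : ℝ) - 2) *
        (1 - s * t) ^ (-(a : ℝ)))) *
        (v ^ (1 - (a : ℝ)) * (1 - v) ^ ((c : ℝ) + (a : ℝ) - 1) * (1 - (1 - s) * v) ^ (-(a : ℝ))) := by
    funext v
    ring
  refine ⟨?_, ?_, ?_, ?_⟩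
  · rw [hfun]
    exact continuousOn_const.mul (elliottPsi_continuousOn ha1R hacR hs)
  · simp only [Real.zero_rpow hne1, mul_zero, zero_mul, neg_zero]
  · simp only [sub_self, Real.zero_rpow hne2, mul_zero, zero_mul, neg_zero]
  · intro u hu
    rw [hfun]
    refine ((elliottPsi_hasDerivAt (a := (a : ℝ)) (c := (c : ℝ)) hs hu).const_mul _).congr_deriv ?_
    have et : t ^ (1 - (a : ℝ)) = t ^ (-(a : ℝ)) * t := by
      rw [← Real.rpow_add_one ht.1.ne', neg_add_eq_sub]
    rw [et]
    ring

end Summit.KontsevichZagierPeriods.KontsevichZagierPeriods.CompleteModGammaSectorEngine
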